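import Mathlib
import Summits.KontsevichZagierPeriods.KontsevichZagierPeriods.Theorems.SoloInformedHookColour
import HarnessLib
import HarnessLib.Audit

/-!
# SoloInformed — the hook sum is a shuffle sum (PROGRAMME LIII, file F5d)

Solo programme `solo-KontsevichZagierPeriods-informed`, session s54. File F5b
(`SoloInformedHookPieces`) expresses the integral side of the hook identity as the sum, over the
linear extensions `σ` of the hook poset `E(m, i)`, of `F` of the binary word read along `σ`; file
F5c (`SoloInformedHookColour`) re-indexes linear extensions by colourings and identifies the word
with an interleaving. Here the two are assembled with LEMMA SW of PROGRAMME XLII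
(`soloInformed_shuffleWord_sum`): for every admissible `u` of weight `m + 1` and every `F` into an
additive commutative monoid,
  `∑_{σ ⊨ E(m,i)} F (word_σ(u)) = ∑_{w ∈ bw(u)⁻ ш 1^{i+1}} F (0 :: w)`
(`soloInformed_hook_sum_eq_shuffleWord`), where `bw(u) = 0 :: bw(u)⁻` is the binary word of `u`
(`soloInformed_binaryWord_eq_cons_tail`) and `1^{i+1}` is the word of `i + 1` letters `1`; in
particular `∑_{σ} Z(idx_σ(u)) = ∑_{w ∈ bw(u)⁻ ш 1^{i+1}} Z(0 :: w)` in `𝒫`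
(`soloInformed_hook_sum_mzvClass_eq_shuffleWord`). This is the dictionary between the geometric
side of LIII (order cells of the hook polytope) and the algebraic language of Kaneko–Yamamoto's
integral-series identity (the element `x (bw(u)⁻ ш y^{i+1})` of the Hoffman algebra): combined with
THEOREM LIII (`soloInformed_hook_identity`, file `SoloInformedHookBase`) it gives the hook identity
in shuffle form (file `SoloInformedHook`).
References: Kaneko–Yamamoto 2018 (arXiv:1605.03117) §4; Ihara–Kaneko–Zagier 2006 §1;
Reutenauer 1993 §1.4; Kontsevich–Zagier 2001 §1.2 [KontsevichZagier2001].
-/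

noncomputable section

open Literature.NumberTheory.Transcendental
open Literature.NumberTheory.Transcendental.KZ

namespace Summit.KontsevichZagierPeriods.KontsevichZagierPeriods.Theorems

variable {m i : ℕ}

/-! ## 1. Sums over linear extensions are sums over colourings -/

/-- **Re-indexing by colourings.** For any `G`,
`∑_{σ ⊨ E(m,i)} G (c(σ)) = ∑_{c : #c⁻¹(true) = m+1, c(0) = true} G c`. -/
theorem soloInformed_sum_hookCompat_eq_sum_colouring {M : Type*} [AddCommMonoid M]
    (G : (Fin (m + 1 + i + 1) → Bool) → M) :
    ∑ σ ∈ Finset.univ.filter (soloInformedCompat (soloInformedHookPoset m i)),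
        G (soloInformedHookColour σ) =
      ∑ c : Fin (m + 1 + i + 1) → Bool,
        if soloInformedCountC c = m + 1 ∧ c 0 = true then G c else 0 := by
  rw [← Finset.sum_filter]
  refine Finset.sum_nbij' (fun σ => soloInformedHookColour σ)
    (fun c => if hc : soloInformedCountC c = m + 1 then soloInformedHookSigma c hc else 1)
    (fun σ hσ => ?_) (fun c hcm => ?_) (fun σ hσ => ?_) (fun c hcm => ?_) fun _ _ => rfl
  · exact Finset.mem_filter.2 ⟨Finset.mem_univ _, soloInformed_countC_hookColour σ,
      soloInformed_hookColour_zero (Finset.mem_filter.1 hσ).2⟩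
  · have hc := (Finset.mem_filter.1 hcm).2
    rw [dif_pos hc.1]
    exact Finset.mem_filter.2 ⟨Finset.mem_univ _, soloInformed_hookSigma_compat c hc.1 hc.2⟩
  · rw [dif_pos (soloInformed_countC_hookColour σ)]
    exact (soloInformed_eq_hookSigma (Finset.mem_filter.1 hσ).2 _).symm
  · have hc := (Finset.mem_filter.1 hcm).2
    rw [dif_pos hc.1]
    exact soloInformed_hookColour_hookSigma c hc.1

/-! ## 2. The hook sum is a shuffle sum -/

/-- The hook sum as a sum over colourings of interleavings. -/
theorem soloInformed_hook_sum_colouring {M : Type*} [AddCommMonoid M] (F : List Bool → M)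
    (u : List ℕ) :
    ∑ σ ∈ Finset.univ.filter (soloInformedCompat (soloInformedHookPoset m i)),
        F (soloInformedHookWordσ u m i σ) =
      ∑ c : Fin (m + 1 + i + 1) → Bool,
        if soloInformedCountC c = m + 1 ∧ c 0 = true then
          F (List.ofFn (soloInformedFillC c (MZV.binaryWord u) (List.replicate (i + 1) true)))
        else 0 := by
  rw [← soloInformed_sum_hookCompat_eq_sum_colouring (m := m) (i := i) fun c =>
    F (List.ofFn (soloInformedFillC c (MZV.binaryWord u) (List.replicate (i + 1) true)))]
  refine Finset.sum_congr rfl fun σ hσ => ?_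
  exact congrArg F (soloInformed_hookWordσ_eq_ofFn_fillC (Finset.mem_filter.1 hσ).2 u)

/-- The binary word of an admissible index of positive weight is `0 :: tail`. -/
theorem soloInformed_binaryWord_eq_cons_tail {u : List ℕ} (hu : MZV.IsAdmissible u)
    (hw : MZV.weight u = m + 1) :
    MZV.binaryWord u = false :: (MZV.binaryWord u).tail ∧ (MZV.binaryWord u).tail.length = m := by
  have hlen : (MZV.binaryWord u).length = m + 1 := soloInformed_length_binaryWord hu hw
  have h0 := soloInformed_wordFn_zero hu hw
  rw [soloInformedWordFn_apply, Fin.val_zero] at h0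
  obtain ⟨b, t, hbt⟩ : ∃ b t, MZV.binaryWord u = b :: t := by
    cases h : MZV.binaryWord u with
    | nil => rw [h] at hlen; exact absurd hlen (by simp)
    | cons b t => exact ⟨b, t, rfl⟩
  rw [hbt, List.getD_cons_zero] at h0
  rw [hbt, List.length_cons] at hlen
  rw [hbt, h0, List.tail_cons]
  exact ⟨rfl, by omega⟩

/-- **THE HOOK SUM IS A SHUFFLE SUM.** For an admissible `u` of weight `m + 1` and any `F`,
`∑_{σ ⊨ E(m,i)} F (word_σ(u)) = ∑_{w ∈ bw(u)⁻ ш 1^{i+1}} F (0 :: w)`. -/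
theorem soloInformed_hook_sum_eq_shuffleWord {M : Type*} [AddCommMonoid M] (F : List Bool → M)
    {u : List ℕ} (hu : MZV.IsAdmissible u) (hw : MZV.weight u = m + 1) :
    ∑ σ ∈ Finset.univ.filter (soloInformedCompat (soloInformedHookPoset m i)),
        F (soloInformedHookWordσ u m i σ) =
      ((MZV.shuffleWord (MZV.binaryWord u).tail (List.replicate (i + 1) true)).map
        fun w => F (false :: w)).sum := by
  obtain ⟨hbt, ht⟩ := soloInformed_binaryWord_eq_cons_tail hu hw
  rw [soloInformed_hook_sum_colouring, soloInformed_shuffleWord_sum _ _ (m + 1 + i) _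
    (by rw [List.length_replicate, ht]; omega), soloInformed_sum_colouring_succ, ht]
  have h2 : ∑ c : Fin (m + 1 + i) → Bool,
      (if soloInformedCountC (Fin.cons false c : Fin (m + 1 + i + 1) → Bool) = m + 1 ∧
          (Fin.cons false c : Fin (m + 1 + i + 1) → Bool) 0 = true then
        F (List.ofFn (soloInformedFillC (Fin.cons false c : Fin (m + 1 + i + 1) → Bool)
          (MZV.binaryWord u) (List.replicate (i + 1) true)))
      else 0) = 0 :=
    Finset.sum_eq_zero fun c _ => by
      rw [if_neg]
      simp only [Fin.cons_zero, Bool.false_eq_true, and_false, not_false_eq_true]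
  rw [h2, add_zero]
  refine Finset.sum_congr rfl fun c _ => ?_
  rw [hbt, List.tail_cons, soloInformed_countC_cons, soloInformed_fillC_cons_true, List.ofFn_cons]
  simp only [Fin.cons_zero, if_true, and_true, Nat.add_right_cancel_iff]

/-- In particular for classes in `𝒫`: the sum of the classes of the simplex pieces of the hook
dissection is the shuffle sum `∑_{w ∈ bw(u)⁻ ш 1^{i+1}} Z(0 :: w)`. -/
theorem soloInformed_hook_sum_mzvClass_eq_shuffleWord {u : List ℕ} (hu : MZV.IsAdmissible u)
    (hw : MZV.weight u = m + 1) :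
    ∑ σ ∈ Finset.univ.filter (soloInformedCompat (soloInformedHookPoset m i)),
        mzvClass (soloInformedHookIdxσ u m i σ) =
      ((MZV.shuffleWord (MZV.binaryWord u).tail (List.replicate (i + 1) true)).map
        fun w => mzvClass (MZV.ofBinaryWord (false :: w))).sum :=
  soloInformed_hook_sum_eq_shuffleWord (fun w => mzvClass (MZV.ofBinaryWord w)) hu hw

end Summit.KontsevichZagierPeriods.KontsevichZagierPeriods.Theorems
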